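import Summits.QuantumFields.YangMills.Theorems.BalabanLadderUVSeamRecCeilingsPolymerRarity
import Summits.QuantumFields.YangMills.Theorems.BalabanLadderUVSeamRecCeilingsDefectCollarMoments
import HarnessLib

/-!
# Crux `UVSeamRec` (stmt-QuantumFields-20043), stub `stub_ceilings` (E0′): the registered ALL-ODD-SIDES currency
# `MomentBounds6` from a tempered centre law plus a large-field POLYMER LAW of the Wilson state — no reflection
# positivity, no divisibility of the torus side

Helper file (`--supports stmt-QuantumFields-20043`) of the width-lever seat `ym-20043-ceilings-p2` (lane B of the stub
`stub_ceilings : UV → MomentBounds6 SU(2) rF uRec`, slot v4-F); sibling of `…CeilingsPolymerRarity.lean` (generic: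
Chebyshev on joint exponential moments; polymer-gas domination).  HONEST FRAMING: consumption-side theorems for OPEN
hypotheses of a conditional chain — (a) a TEMPERED centre law (E0′-K with background field, for exteriors of small
«influence») and (EM)/(PL) a joint-exponential-moment / Peierls-product-law bound for the large-field polymer gas of the
Wilson state on ODD tori (renormalisation-group content of the kind of Bałaban's large-field analysis, neither in the
route's `UV` nor printed on odd tori).  Nothing of E0′ is claimed; not a gap, not Clay.

WHERE IT SITS.  Lane A (seam-s2, p518354–p524464) typed the chain «good-exterior law (a) + multiplicative rarity (b) ⇒
ceilings» and supplies (b) by a BLOCK CHESSBOARD estimate, available exactly when the torus side is tiled by equal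
blocks of the collar width — hence only for a CLASS of sides (`MomentBounds6OnSides … familySides`), never for the
registered `MomentBounds6`, which quantifies over ALL odd sides `2L+1`, primes included (note
`CEILINGS-KERNEL-ANALYSIS-seam-s2.md` rev 2 §5: «multiplicative rarity on prime odd tori is an odd-torus large-field
statement with no RP shortcut»).  This file types that statement in the currency a polymer / cluster expansion of the
large-field indicator gas delivers, and proves that it suffices:

* §1 `rarity_of_expMoment` — hypothesis (b) of `DefectCollar.momentBounds6_of_goodLaw_and_rarity` for the tempered
  sets `Good β R q x := {η | I β R q x η < θ β R}` of a bounded measurable INFLUENCE FUNCTIONAL `I`, from (EM): on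
  every odd torus the joint exponential moment of the influences of cyclically separated cubes is multiplicatively
  bounded, `⟨exp(λ Σ_{i∈T} I_i)⟩_{2L+1,β} ≤ exp(B·#T)`, with `exp(B − λθ) ≤ C₂/R⁴`.
* §2 **`momentBounds6_of_temperedLaw_and_expMoment`** — (a) tempered centre law + (EM) ⇒ `MomentBounds6 G r a` (all
  odd sides).
* §3 `rarity_of_polymerLaw`, **`momentBounds6_of_temperedLaw_and_polymerLaw`** — the same with (EM) replaced by its
  polymer-gas supplier (PL): on every odd torus, for every separated family of cubes, a finite family of measurable
  «polymer» events `E_γ` with weights `w_γ ≥ 0` and influence coefficients `c_{iγ} ≥ 0` such that the influence of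
  cube `i` is dominated by `Σ_γ c_{iγ} 1_{E_γ}`, one polymer's total influence is `≤ Λ`, the mean influence on one cube
  is `Σ_γ c_{iγ} w_γ ≤ W` (the «density `e^{−cβ}`» number), the Wilson state obeys the Peierls PRODUCT LAW
  `⟨∏_{γ∈A} 1_{E_γ}⟩ ≤ ∏_{γ∈A} w_γ`, and `exp(λ e^{λΛ} W − λθ) ≤ C₂/R⁴`.

References: H.-O. Georgii, *Gibbs Measures and Phase Transitions* (2011) Thm. 4.17 (the DLR part, via p518354);
R. Kotecký, D. Preiss, Commun. Math. Phys. 103 (1986) 491–498 and D. Brydges, Les Houches 1984 §2 (polymer gas); the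
intended (PL) input is of the kind of T. Bałaban, Commun. Math. Phys. 122 (1989) 175–202 / 355–392 (large-field
regions of the renormalised densities are suppressed exponentially in their size).
-/

set_option autoImplicit false

noncomputable section

open MeasureTheory Filter Topology Finset
open Literature.Probability.LatticeModels
open Literature.MathematicalPhysics.QuantumFieldTheory (GaugeConfig wilsonMeasure isProbabilityMeasure_wilsonMeasure
  measurable_torusLift LatticeRep)
open Literature.MathematicalPhysics.QuantumLattice
open Summit.QuantumFields.YangMills.Cruxes.UVSeamRec.DefectCollar (integral_prod_indicator_eq_measureReal
  momentBounds6_of_goodLaw_and_rarity)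

namespace Summit.QuantumFields.YangMills.Cruxes.UVSeamRec.PolymerRarity

open Summit.QuantumFields.YangMills.Cruxes.OSLegsFromFemtoAndGap.DlrCollarTransfer

/-! ## §0 Two bookkeeping identities -/

section Bookkeeping

variable {α β : Type*}

/-- The indicator of a preimage is the indicator composed with the map. [folklore] -/
theorem indicator_one_preimage (f : β → α) (s : Set α) (x : β) :
    (f ⁻¹' s).indicator (fun _ => (1 : ℝ)) x = s.indicator (fun _ => (1 : ℝ)) (f x) := by
  by_cases h : f x ∈ s
  · rw [Set.indicator_of_mem h, Set.indicator_of_mem (show x ∈ f ⁻¹' s from h)]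
  · rw [Set.indicator_of_notMem h, Set.indicator_of_notMem (show x ∉ f ⁻¹' s from h)]

/-- The complement of a strict sub-level set is the super-level set. [folklore] -/
theorem compl_setOf_lt (I : α → ℝ) (θ : ℝ) : {η | I η < θ}ᶜ = {η | θ ≤ I η} := by
  ext η
  simp [not_lt]

end Bookkeeping

/-! ## §1 Hypothesis (b) of the defect collar from a joint exponential moment bound on every odd torus -/

section Route

variable {G : Type} [Group G] [TopologicalSpace G] [IsTopologicalGroup G] [CompactSpace G]
  [MeasurableSpace G] [BorelSpace G] (r : LatticeRep G) (a : ℝ → ℝ)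

/-- **Multiplicative rarity of the non-tempered cube-exteriors from (EM), on every odd torus.**  Data: a measurable
influence functional `I β R q x : LGConfig 4 G → ℝ` of the exterior of the radius-`R+1` cube around `x`
(orientation `q`), bounded by `M β R`; a threshold `θ β R`; a tilt `λ β R ≥ 0` and a budget `B β R` with
`exp(B β R − λ β R · θ β R) ≤ C₂/R⁴`; and (EM): for `β ≥ β₁`, on every odd torus `(ℤ/(2L+1))⁴` with `4R+8 ≤ L`, for sites
pairwise cyclically `2R+4`-separated in some coordinate and every set `T` of indices,
`⟨exp(λ β R · Σ_{i∈T} I β R (q i) (x i))⟩_{2L+1,β} ≤ exp(B β R · #T)`.  THEN the tempered sets `Good := {I < θ}` satisfy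
hypothesis (b) of `DefectCollar.momentBounds6_of_goodLaw_and_rarity`: `⟨∏_{i∈T} 1[lift ∉ Good]⟩ ≤ (C₂/R⁴)^{#T}`.
Proof: `PolymerRarity.measureReal_biInter_le_pow_of_expMoment` on the Wilson torus state (Chebyshev); no reflection
positivity, no tiling — every odd side, primes included. [folklore] -/
theorem rarity_of_expMoment {C₂ β₁ ℓ₁ : ℝ} (I : ℝ → ℕ → Fin 4 × Fin 4 → (Fin 4 → ℤ) → LGConfig 4 G → ℝ)
    (M θ lam B : ℝ → ℕ → ℝ)
    (hIm : ∀ β R q x, Measurable (I β R q x)) (hIb : ∀ β R q x η, |I β R q x η| ≤ M β R)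
    (hlam : ∀ β R, 0 ≤ lam β R)
    (hnum : ∀ β : ℝ, β₁ ≤ β → ∀ R : ℕ, 1 ≤ R → (R : ℝ) * a β ≤ ℓ₁ →
      Real.exp (B β R - lam β R * θ β R) ≤ C₂ / (R : ℝ) ^ 4)
    (hEM : ∀ β : ℝ, β₁ ≤ β → ∀ (L n : ℕ) (q : Fin n → Fin 4 × Fin 4) (x : Fin n → (Fin 4 → ℤ)) (R : ℕ),
      (∀ i, (q i).1 < (q i).2) → 1 ≤ R → (R : ℝ) * a β ≤ ℓ₁ → 4 * R + 8 ≤ L →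
      (∀ i j : Fin n, i ≠ j → ∃ k : Fin 4,
        (2 * (R : ℤ) + 4) ≤ |((((x i k - x j k : ℤ) : ZMod (2 * L + 1))).valMinAbs : ℤ)|) →
      ∀ T : Finset (Fin n),
        torusE G r β L (fun U => Real.exp (lam β R * ∑ i ∈ T, I β R (q i) (x i) U)) ≤
          Real.exp (B β R * T.card)) :
    ∀ β : ℝ, β₁ ≤ β → ∀ (L n : ℕ) (q : Fin n → Fin 4 × Fin 4) (x : Fin n → (Fin 4 → ℤ)) (R : ℕ),
      (∀ i, (q i).1 < (q i).2) → 1 ≤ R → (R : ℝ) * a β ≤ ℓ₁ → 4 * R + 8 ≤ L →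
      (∀ i j : Fin n, i ≠ j → ∃ k : Fin 4,
        (2 * (R : ℤ) + 4) ≤ |((((x i k - x j k : ℤ) : ZMod (2 * L + 1))).valMinAbs : ℤ)|) →
      ∀ T : Finset (Fin n),
        torusE G r β L (fun U => ∏ i ∈ T,
          ({η | I β R (q i) (x i) η < θ β R})ᶜ.indicator (fun _ => (1 : ℝ)) U) ≤
          (C₂ / (R : ℝ) ^ 4) ^ T.card := by
  intro β hβ L n q x R hq hR hRa hRL hsep T
  haveI := isProbabilityMeasure_wilsonMeasure (d := 4) (L := 2 * L + 1) r.ρ r.continuous β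
  -- the influence functionals read on the torus
  set J : Fin n → GaugeConfig 4 (2 * L + 1) G → ℝ := fun i U => I β R (q i) (x i) (torusLift (2 * L + 1) U)
    with hJdef
  have hJm : ∀ i, Measurable (J i) := fun i => (hIm β R (q i) (x i)).comp (measurable_torusLift _)
  -- the integrand of (b) is the indicator product of the super-level sets of the `J i`
  have hind : ∀ U : GaugeConfig 4 (2 * L + 1) G,
      (∏ i ∈ T, ({η | I β R (q i) (x i) η < θ β R})ᶜ.indicator (fun _ => (1 : ℝ)) (torusLift (2 * L + 1) U)) =
        ∏ i ∈ T, {U | θ β R ≤ J i U}.indicator (fun _ => (1 : ℝ)) U := by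
    intro U
    refine Finset.prod_congr rfl fun i _ => ?_
    rw [compl_setOf_lt, ← indicator_one_preimage]
    rfl
  have hmeas : ∀ i, MeasurableSet {U | θ β R ≤ J i U} := fun i => measurableSet_le measurable_const (hJm i)
  -- integrability of the joint tilt (bounded measurable on a probability space)
  have hint : Integrable (fun U => Real.exp (lam β R * ∑ i ∈ T, J i U))
      (wilsonMeasure (d := 4) (L := 2 * L + 1) r.ρ β) := by
    refine integrable_of_abs_le ((Finset.measurable_sum T fun i _ => hJm i).const_mul _).exp
      (C := Real.exp (lam β R * ∑ _i ∈ T, M β R)) fun U => ?_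
    rw [Real.abs_exp]
    refine Real.exp_le_exp.2 (mul_le_mul_of_nonneg_left (Finset.sum_le_sum fun i _ => ?_) (hlam β R))
    exact (le_abs_self _).trans (hIb β R (q i) (x i) _)
  have hmom : ∫ U, Real.exp (lam β R * ∑ i ∈ T, J i U) ∂(wilsonMeasure (d := 4) (L := 2 * L + 1) r.ρ β) ≤
      Real.exp (B β R * T.card) := hEM β hβ L n q x R hq hR hRa hRL hsep T
  have key := measureReal_biInter_le_pow_of_expMoment (wilsonMeasure (d := 4) (L := 2 * L + 1) r.ρ β) T J hJm
    (θ β R) (hlam β R) hint hmom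
  -- assemble
  show ∫ U, (∏ i ∈ T, ({η | I β R (q i) (x i) η < θ β R})ᶜ.indicator (fun _ => (1 : ℝ))
      (torusLift (2 * L + 1) U)) ∂(wilsonMeasure (d := 4) (L := 2 * L + 1) r.ρ β) ≤ (C₂ / (R : ℝ) ^ 4) ^ T.card
  simp_rw [hind]
  rw [integral_prod_indicator_eq_measureReal _ T _ hmeas]
  exact key.trans (pow_le_pow_left₀ (Real.exp_nonneg _) (hnum β hβ R hR hRa) _)

/-! ## §2 `MomentBounds6` (all odd sides) from a tempered centre law and (EM) -/

/-- **`MomentBounds6 G r a` from a TEMPERED centre law plus the joint exponential moment bound (EM) — the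
all-odd-sides currency, with no reflection positivity and no divisibility hypothesis.**  Data as in
`rarity_of_expMoment` (influence functional `I`, bound `M`, threshold `θ`, tilt `λ ≥ 0`, budget `B`,
`exp(B − λθ) ≤ C₂/R⁴`, (EM) on every odd torus) plus (a) the TEMPERED CENTRE LAW: for `β ≥ β₁`, `1 ≤ R`,
`R · a β ≤ ℓ₁`, every orientation `q.1 < q.2`, site `x`, and every exterior `η` of influence `I β R q x η < θ β R`, the
cube-kernel mean of `plane q x` over the radius-`R+1` cube around `x` is within `C₁/R⁴` of `p q β` (`|p| ≤ P₀`).  THEN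
`MomentBounds6 G r a` (constant `2C₁ + 2(C_A + P₀)C₂`, thresholds `β₁`, `ℓ₁`).  Proof: §1 + seam-s2's
`DefectCollar.momentBounds6_of_goodLaw_and_rarity` with `Good := {I < θ}`. [folklore: Georgii (2011) Thm. 4.17 for the
DLR part] -/
theorem momentBounds6_of_temperedLaw_and_expMoment {C₁ C₂ β₁ ℓ₁ P₀ : ℝ} {p : Fin 4 × Fin 4 → ℝ → ℝ}
    (I : ℝ → ℕ → Fin 4 × Fin 4 → (Fin 4 → ℤ) → LGConfig 4 G → ℝ) (M θ lam B : ℝ → ℕ → ℝ)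
    (hℓ₁ : 0 < ℓ₁) (hC₁ : 0 ≤ C₁) (hC₂ : 0 ≤ C₂) (hp : ∀ q β, |p q β| ≤ P₀)
    (hIm : ∀ β R q x, Measurable (I β R q x)) (hIb : ∀ β R q x η, |I β R q x η| ≤ M β R)
    (hlam : ∀ β R, 0 ≤ lam β R)
    (hnum : ∀ β : ℝ, β₁ ≤ β → ∀ R : ℕ, 1 ≤ R → (R : ℝ) * a β ≤ ℓ₁ →
      Real.exp (B β R - lam β R * θ β R) ≤ C₂ / (R : ℝ) ^ 4)
    (hlaw : ∀ β : ℝ, β₁ ≤ β → ∀ R : ℕ, 1 ≤ R → (R : ℝ) * a β ≤ ℓ₁ →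
      ∀ (q : Fin 4 × Fin 4) (x : Fin 4 → ℤ), q.1 < q.2 → ∀ η : LGConfig 4 G, I β R q x η < θ β R →
        |kerE G r β (fun k => x k - (R + 1)) (2 * R + 3) η (plane G r q x) - p q β| ≤ C₁ / (R : ℝ) ^ 4)
    (hEM : ∀ β : ℝ, β₁ ≤ β → ∀ (L n : ℕ) (q : Fin n → Fin 4 × Fin 4) (x : Fin n → (Fin 4 → ℤ)) (R : ℕ),
      (∀ i, (q i).1 < (q i).2) → 1 ≤ R → (R : ℝ) * a β ≤ ℓ₁ → 4 * R + 8 ≤ L →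
      (∀ i j : Fin n, i ≠ j → ∃ k : Fin 4,
        (2 * (R : ℤ) + 4) ≤ |((((x i k - x j k : ℤ) : ZMod (2 * L + 1))).valMinAbs : ℤ)|) →
      ∀ T : Finset (Fin n),
        torusE G r β L (fun U => Real.exp (lam β R * ∑ i ∈ T, I β R (q i) (x i) U)) ≤
          Real.exp (B β R * T.card)) :
    MomentBounds6 G r a :=
  momentBounds6_of_goodLaw_and_rarity r a (fun β R q x => {η | I β R q x η < θ β R}) hℓ₁ hC₁ hC₂ hp
    (fun β R q x => measurableSet_lt (hIm β R q x) measurable_const)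
    (fun β hβ R hR hRa q x hq η hη => hlaw β hβ R hR hRa q x hq η hη)
    (rarity_of_expMoment r a I M θ lam B hIm hIb hlam hnum hEM)

/-! ## §3 The polymer-gas supplier: `MomentBounds6` from a tempered centre law and the Peierls product law (PL) -/

/-- **Multiplicative rarity of the non-tempered cube-exteriors from the POLYMER LAW (PL), on every odd torus.**
Data: a measurable influence functional `I` with threshold `θ`, tilt `λ ≥ 0`, one-polymer influence bound `Λ`, density
number `W`, with `exp(λ e^{λΛ} W − λθ) ≤ C₂/R⁴`; and (PL): for `β ≥ β₁`, on every odd torus `(ℤ/(2L+1))⁴` with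
`4R+8 ≤ L`, for every cyclically separated family of cubes there are finitely many measurable POLYMER EVENTS `E_γ`
(`γ ∈ S`, any index type), weights `w_γ ≥ 0` and influence coefficients `c_{iγ} ≥ 0` such that (i) the influence of
each cube is dominated on torus configurations, `I_i(lift U) ≤ Σ_{γ∈S} c_{iγ} 1_{E_γ}(lift U)`; (ii) `Σ_i c_{iγ} ≤ Λ`;
(iii) `Σ_γ c_{iγ} w_γ ≤ W`; (iv) the Wilson state obeys the Peierls PRODUCT LAW `⟨∏_{γ∈A} 1_{E_γ}∘lift⟩ ≤ ∏_{γ∈A} w_γ`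
for every `A ⊆ S`.  THEN `Good := {I < θ}` satisfies hypothesis (b) of `DefectCollar.momentBounds6_of_goodLaw_and_rarity`.
Proof: domination + `PolymerRarity.measureReal_biInter_le_pow_of_polymerLaw` on the Wilson torus state. [folklore;
the (PL) input is of Bałaban's large-field kind] -/
theorem rarity_of_polymerLaw {C₂ β₁ ℓ₁ : ℝ} (I : ℝ → ℕ → Fin 4 × Fin 4 → (Fin 4 → ℤ) → LGConfig 4 G → ℝ)
    (θ lam Λ W : ℝ → ℕ → ℝ)
    (hIm : ∀ β R q x, Measurable (I β R q x)) (hlam : ∀ β R, 0 ≤ lam β R)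
    (hnum : ∀ β : ℝ, β₁ ≤ β → ∀ R : ℕ, 1 ≤ R → (R : ℝ) * a β ≤ ℓ₁ →
      Real.exp (lam β R * Real.exp (lam β R * Λ β R) * W β R - lam β R * θ β R) ≤ C₂ / (R : ℝ) ^ 4)
    (hPL : ∀ β : ℝ, β₁ ≤ β → ∀ (L n : ℕ) (q : Fin n → Fin 4 × Fin 4) (x : Fin n → (Fin 4 → ℤ)) (R : ℕ),
      (∀ i, (q i).1 < (q i).2) → 1 ≤ R → (R : ℝ) * a β ≤ ℓ₁ → 4 * R + 8 ≤ L →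
      (∀ i j : Fin n, i ≠ j → ∃ k : Fin 4,
        (2 * (R : ℤ) + 4) ≤ |((((x i k - x j k : ℤ) : ZMod (2 * L + 1))).valMinAbs : ℤ)|) →
      ∃ (κ : Type) (S : Finset κ) (E : κ → Set (LGConfig 4 G)) (w : κ → ℝ) (c : Fin n → κ → ℝ),
        (∀ γ, MeasurableSet (E γ)) ∧ (∀ γ ∈ S, 0 ≤ w γ) ∧ (∀ i, ∀ γ ∈ S, 0 ≤ c i γ) ∧
        (∀ (i : Fin n) (U : GaugeConfig 4 (2 * L + 1) G),
          I β R (q i) (x i) (torusLift (2 * L + 1) U) ≤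
            ∑ γ ∈ S, c i γ * (E γ).indicator (fun _ => (1 : ℝ)) (torusLift (2 * L + 1) U)) ∧
        (∀ γ ∈ S, ∑ i, c i γ ≤ Λ β R) ∧ (∀ i, ∑ γ ∈ S, c i γ * w γ ≤ W β R) ∧
        (∀ A, A ⊆ S → torusE G r β L (fun U => ∏ γ ∈ A, (E γ).indicator (fun _ => (1 : ℝ)) U) ≤
          ∏ γ ∈ A, w γ)) :
    ∀ β : ℝ, β₁ ≤ β → ∀ (L n : ℕ) (q : Fin n → Fin 4 × Fin 4) (x : Fin n → (Fin 4 → ℤ)) (R : ℕ),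
      (∀ i, (q i).1 < (q i).2) → 1 ≤ R → (R : ℝ) * a β ≤ ℓ₁ → 4 * R + 8 ≤ L →
      (∀ i j : Fin n, i ≠ j → ∃ k : Fin 4,
        (2 * (R : ℤ) + 4) ≤ |((((x i k - x j k : ℤ) : ZMod (2 * L + 1))).valMinAbs : ℤ)|) →
      ∀ T : Finset (Fin n),
        torusE G r β L (fun U => ∏ i ∈ T,
          ({η | I β R (q i) (x i) η < θ β R})ᶜ.indicator (fun _ => (1 : ℝ)) U) ≤
          (C₂ / (R : ℝ) ^ 4) ^ T.card := by
  intro β hβ L n q x R hq hR hRa hRL hsep T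
  haveI := isProbabilityMeasure_wilsonMeasure (d := 4) (L := 2 * L + 1) r.ρ r.continuous β
  obtain ⟨κ, S, E, w, c, hE, hw, hc, hdom, hΛ, hW, hpl⟩ := hPL β hβ L n q x R hq hR hRa hRL hsep
  -- the polymer events and the influence functionals read on the torus
  set E' : κ → Set (GaugeConfig 4 (2 * L + 1) G) := fun γ => (torusLift (2 * L + 1)) ⁻¹' (E γ) with hE'def
  have hE' : ∀ γ, MeasurableSet (E' γ) := fun γ => measurable_torusLift _ (hE γ)
  set J : Fin n → GaugeConfig 4 (2 * L + 1) G → ℝ := fun i U => I β R (q i) (x i) (torusLift (2 * L + 1) U)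
    with hJdef
  have hJm : ∀ i, Measurable (J i) := fun i => (hIm β R (q i) (x i)).comp (measurable_torusLift _)
  have hind : ∀ U : GaugeConfig 4 (2 * L + 1) G,
      (∏ i ∈ T, ({η | I β R (q i) (x i) η < θ β R})ᶜ.indicator (fun _ => (1 : ℝ)) (torusLift (2 * L + 1) U)) =
        ∏ i ∈ T, {U | θ β R ≤ J i U}.indicator (fun _ => (1 : ℝ)) U := by
    intro U
    refine Finset.prod_congr rfl fun i _ => ?_
    rw [compl_setOf_lt, ← indicator_one_preimage]
    rfl
  have hmeas : ∀ i, MeasurableSet {U | θ β R ≤ J i U} := fun i => measurableSet_le measurable_const (hJm i)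
  -- domination of the bad events by the super-level sets of the linear influence functionals
  have hdom' : ∀ i ∈ T, {U | θ β R ≤ J i U} ⊆
      {U | θ β R ≤ ∑ γ ∈ S, c i γ * (E' γ).indicator (fun _ => (1 : ℝ)) U} := by
    intro i _ U hU
    have h1 : θ β R ≤ J i U := hU
    refine h1.trans ?_
    have h2 := hdom i U
    simp only [hE'def, indicator_one_preimage]
    exact h2
  -- the product law on the torus
  have hpl' : ∀ A, A ⊆ S → (wilsonMeasure (d := 4) (L := 2 * L + 1) r.ρ β).real (⋂ γ ∈ A, E' γ) ≤
      ∏ γ ∈ A, w γ := by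
    intro A hA
    rw [← integral_prod_indicator_eq_measureReal _ A E' hE']
    have h1 := hpl A hA
    simp only [torusE] at h1
    simp_rw [hE'def, indicator_one_preimage]
    exact h1
  -- influence bookkeeping restricted to `T`
  have hc' : ∀ i ∈ T, ∀ γ ∈ S, 0 ≤ c i γ := fun i _ γ hγ => hc i γ hγ
  have hΛ' : ∀ γ ∈ S, ∑ i ∈ T, c i γ ≤ Λ β R := fun γ hγ =>
    (Finset.sum_le_univ_sum_of_nonneg fun i => hc i γ hγ).trans (hΛ γ hγ)
  have hW' : ∀ i ∈ T, ∑ γ ∈ S, c i γ * w γ ≤ W β R := fun i _ => hW i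
  have key := measureReal_biInter_le_pow_of_polymerLaw (wilsonMeasure (d := 4) (L := 2 * L + 1) r.ρ β) T S E' hE'
    w hw c hc' (θ β R) (hlam β R) hΛ' hW' hpl'
  -- assemble
  show ∫ U, (∏ i ∈ T, ({η | I β R (q i) (x i) η < θ β R})ᶜ.indicator (fun _ => (1 : ℝ))
      (torusLift (2 * L + 1) U)) ∂(wilsonMeasure (d := 4) (L := 2 * L + 1) r.ρ β) ≤ (C₂ / (R : ℝ) ^ 4) ^ T.card
  simp_rw [hind]
  rw [integral_prod_indicator_eq_measureReal _ T _ hmeas]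
  exact ((measureReal_biInter_le_of_subset_superlevel _ T _ _ (θ β R) hdom').trans key).trans
    (pow_le_pow_left₀ (Real.exp_nonneg _) (hnum β hβ R hR hRa) _)

/-- **`MomentBounds6 G r a` from a TEMPERED centre law plus the POLYMER LAW (PL) of the Wilson state on odd tori —
the all-odd-sides currency via the polymer / cluster-expansion supplier of multiplicative rarity; no reflection
positivity, no divisibility of the side.**  Data: measurable influence functional `I` with threshold `θ`, tilt
`λ ≥ 0`, one-polymer influence bound `Λ`, density number `W`, `exp(λ e^{λΛ} W − λθ) ≤ C₂/R⁴`; (a) the tempered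
centre law for exteriors with `I < θ`; (PL) as in `rarity_of_polymerLaw`.  THEN `MomentBounds6 G r a` with constant
`2C₁ + 2(C_A + P₀)C₂`.  Proof: §3 `rarity_of_polymerLaw` + seam-s2's `DefectCollar.momentBounds6_of_goodLaw_and_rarity`.
[folklore: Georgii (2011) Thm. 4.17 for the DLR part; the (PL) input is of Bałaban's large-field kind] -/
theorem momentBounds6_of_temperedLaw_and_polymerLaw {C₁ C₂ β₁ ℓ₁ P₀ : ℝ} {p : Fin 4 × Fin 4 → ℝ → ℝ}
    (I : ℝ → ℕ → Fin 4 × Fin 4 → (Fin 4 → ℤ) → LGConfig 4 G → ℝ) (θ lam Λ W : ℝ → ℕ → ℝ)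
    (hℓ₁ : 0 < ℓ₁) (hC₁ : 0 ≤ C₁) (hC₂ : 0 ≤ C₂) (hp : ∀ q β, |p q β| ≤ P₀)
    (hIm : ∀ β R q x, Measurable (I β R q x)) (hlam : ∀ β R, 0 ≤ lam β R)
    (hnum : ∀ β : ℝ, β₁ ≤ β → ∀ R : ℕ, 1 ≤ R → (R : ℝ) * a β ≤ ℓ₁ →
      Real.exp (lam β R * Real.exp (lam β R * Λ β R) * W β R - lam β R * θ β R) ≤ C₂ / (R : ℝ) ^ 4)
    (hlaw : ∀ β : ℝ, β₁ ≤ β → ∀ R : ℕ, 1 ≤ R → (R : ℝ) * a β ≤ ℓ₁ →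
      ∀ (q : Fin 4 × Fin 4) (x : Fin 4 → ℤ), q.1 < q.2 → ∀ η : LGConfig 4 G, I β R q x η < θ β R →
        |kerE G r β (fun k => x k - (R + 1)) (2 * R + 3) η (plane G r q x) - p q β| ≤ C₁ / (R : ℝ) ^ 4)
    (hPL : ∀ β : ℝ, β₁ ≤ β → ∀ (L n : ℕ) (q : Fin n → Fin 4 × Fin 4) (x : Fin n → (Fin 4 → ℤ)) (R : ℕ),
      (∀ i, (q i).1 < (q i).2) → 1 ≤ R → (R : ℝ) * a β ≤ ℓ₁ → 4 * R + 8 ≤ L →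
      (∀ i j : Fin n, i ≠ j → ∃ k : Fin 4,
        (2 * (R : ℤ) + 4) ≤ |((((x i k - x j k : ℤ) : ZMod (2 * L + 1))).valMinAbs : ℤ)|) →
      ∃ (κ : Type) (S : Finset κ) (E : κ → Set (LGConfig 4 G)) (w : κ → ℝ) (c : Fin n → κ → ℝ),
        (∀ γ, MeasurableSet (E γ)) ∧ (∀ γ ∈ S, 0 ≤ w γ) ∧ (∀ i, ∀ γ ∈ S, 0 ≤ c i γ) ∧
        (∀ (i : Fin n) (U : GaugeConfig 4 (2 * L + 1) G),
          I β R (q i) (x i) (torusLift (2 * L + 1) U) ≤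
            ∑ γ ∈ S, c i γ * (E γ).indicator (fun _ => (1 : ℝ)) (torusLift (2 * L + 1) U)) ∧
        (∀ γ ∈ S, ∑ i, c i γ ≤ Λ β R) ∧ (∀ i, ∑ γ ∈ S, c i γ * w γ ≤ W β R) ∧
        (∀ A, A ⊆ S → torusE G r β L (fun U => ∏ γ ∈ A, (E γ).indicator (fun _ => (1 : ℝ)) U) ≤
          ∏ γ ∈ A, w γ)) :
    MomentBounds6 G r a :=
  momentBounds6_of_goodLaw_and_rarity r a (fun β R q x => {η | I β R q x η < θ β R}) hℓ₁ hC₁ hC₂ hp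
    (fun β R q x => measurableSet_lt (hIm β R q x) measurable_const)
    (fun β hβ R hR hRa q x hq η hη => hlaw β hβ R hR hRa q x hq η hη)
    (rarity_of_polymerLaw r a I θ lam Λ W hIm hlam hnum hPL)

end Route

end Summit.QuantumFields.YangMills.Cruxes.UVSeamRec.PolymerRarity

end
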